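import Summits.BirchSwinnertonDyer.BirchSwinnertonDyer.Theorems.PrintX8SmallImageRiderRankZero
import Summits.BirchSwinnertonDyer.Rank1Residual.PrintX8.CertificateClaim
import HarnessLib

/-!
# Route `PrintX8`, crux `MuBoundSmallImageX8` (stmt-BirchSwinnertonDyer-20622), ANALYTIC RANK `0`, part 2:
# Sprung's Main Conjecture 7.21 and K1's predicate on the small-image X8 pairs with `3 ∤ #Ш_an`, K1-FREE,
# from the one-colour analytic rider — and the CLASS FORMS (cell `bsd-print-x8`, D-0131 (2) print tier,
# seat p3 gen 2 «… NO ⇒ the exact missing input is the crux»; `--supports` 20622; theorems only)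

PARTITION (cell bsd-print-x8, leaf `ClassX8`; 217 census cells, 61 with image `N_ns⁺(3)`): per-pair and
class theorems CONDITIONAL on published named facts + the displayed analytic rider; closes NONE; 0 census
cells move by class theorem; BSD is not proved by any of this. beyond-print theorem: YES (as part 1:
integral Kato-side bound and Main Conj. 7.21 for the unit-content colour at NON-surjective `3`-adic image).

HONEST FRAMING. Part 1 (`PrintX8SmallImageRiderRankZero`): on X8 ∧ `¬ surj(3)` ∧ `r_an = 0`, ONE colour of
unit content ⟹ `ord₃ #Ш ≤ ord₃ #Ш_an` (integral, through the reduction-free core) ⟹ `BSD(E,3)` when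
`3 ∤ #Ш_an` (54 of the 61 small-image census cells). THIS file: with `BSD(E,3)` settled at rank `0`, the
rider for `•` also gives Sprung's Main Conjecture 7.21 for `•` (the ♯/♭, image-free twin of K3's
`kobayashiMainConjecture_of_mu_eq_zero_of_bsdp_of_analyticRank_eq_zero`: `μ(X^•) = 0` + `ξ ∣ L^•` + the
rank-`0` exact form `BSD(E,3) ⟺ (ξ) = (L^•)`), hence K1's predicate at the pair — so on those 54 cells
NEITHER open crux of the route (19875 K1, 20622 Mu) is needed beyond PUB + `hCK` + per-pair certificates
(one Mazur–Tate layer per colour, p3 g1 `PrintX8MazurTateMuRider`; the `#Ш_an` certificate, ty3). The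
residual of the small-image branch of leaf `WAllCornerX8` thereby shrinks, modulo the rider, to the 6
rank-`0` cells with `3 ∣ #Ш_an` (LOWER half: K1 or a `3`- or `9`-descent certificate) and the rank-`1` cell
478400hc1. PRIOR ART: `BSD(E,3)` PER PAIR on these 54 cells already has an elementary road in the tree —
b2b's EXACT `3`-descent records `Supersingular/NonsplitCartanThreeDescentRecordsX8Three01–05.lean`
(`#Sel³ = 3^{r_an}` ⟹ `Ш[3] = 0`); §3's `…_of_bsdp_of_sharpFlatMuAn_…` takes `BSD(E,3)` as a DISPLAYED input,
so it upgrades EITHER road (descent line or part 1's rider road) to the `Λ`-adic Main Conjecture 7.21 for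
the unit-content colour — the statement no descent reaches. The rider class-wide is Perrin-Riou 2003
Conj. 7.1 (OPEN); nothing is booked.

## Contents
* §3 `X8.sprungSharpFlatMainConjecture_of_bsdp_of_sharpFlatMuAn_…` (BSD(E,3) + rider(•) ⟹ MC 7.21 for •);
  `X8.sprungSharpFlatMainConjecture_of_sharpFlatMuAn_of_shaAn_le_…` (rider(•) + `ord₃ #Ш_an ≤ 0` ⟹ MC);
  `X8.sprungSharpFlatLowerDivisibility_of_sharpFlatMuAn_of_shaAn_le_…` (⟹ K1's predicate at the pair).
* §4 CLASS FORMS: `upperHalf_smallImage_rankZero_of_oneColourRider`,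
  `bsdp_smallImage_rankZero_shaUnit_of_oneColourRider`,
  `sharpFlatMainConjecture_smallImage_rankZero_shaUnit_of_sharpFlatMuAn`.
* §5 RECORD LEVEL (ty3's `Rank1Residual/PrintX8/CertificateRecords*.lean`, `Record.Claim`):
  `certificateRecord_bsdp_of_mazurTate_smallImage_rankZero_shaUnit` — a certified record with
  `surj3 = false`, `rank = 0`, `ord₃ shaAn = 0` + ONE certified Mazur–Tate layer ⟹ `BSD(E,3)` for the
  record's curve (the per-cell consumer the 54 cells plug into).

References: [Sprung2012] Thm. 7.14, Thm. 7.16, Main Conj. 1.3 / 7.21 (pp. 1486, 1504–1505); [Sprung2024]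
§5.2 Lemmas 5.5–5.9; [Sprung2017] Thm. 1.12; [PerrinRiou2003] Conj. 7.1; [GreenbergVatsal2000] §3 Rem. 3.4;
[Miller2011LMS] Def. 1.1; tree: part 1, p2 `X8SharpFlatKatoUpperHalf`, b2b `SharpFlatConverseReal`, p1 g2
`PrintX8SharpFlatMuTransfer`, K3 `…SmallImageMuSaturation`.
-/

set_option autoImplicit false
-- justification: the mandated namespace `Summit.BirchSwinnertonDyer.BirchSwinnertonDyer.Theorems`
-- (single-conjunct summit, Sub = Summit) repeats a segment by design (D-0017).
set_option linter.dupNamespace false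

noncomputable section

open scoped Classical NumberField MatrixGroups ModularForm

open NumberField IsDedekindDomain WeierstrassCurve CongruenceSubgroup Field
  Literature.NumberTheory.EllipticCurves Literature.NumberTheory.EllipticCurves.ModularForms
  Literature.NumberTheory.EllipticCurves.Rank1Residual
  Literature.NumberTheory.EllipticCurves.Rank1Residual.Typed
  Literature.NumberTheory.EllipticCurves.Sprung2017 Literature.NumberTheory.EllipticCurves.Sprung2012
  Literature.NumberTheory.EllipticCurves.Sprung2024
  Literature.NumberTheory.EllipticCurves.GreenbergVatsal2000
  Literature.NumberTheory.EllipticCurves.ZpExtension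
  Summit.BirchSwinnertonDyer.BirchSwinnertonDyer.Theorems
  Summit.BirchSwinnertonDyer.BirchSwinnertonDyer.Theorems.PrintX8SmallImageRiderRankZero
  Summit.BirchSwinnertonDyer.Rank1Residual.Supersingular
  Summit.BirchSwinnertonDyer.Rank1Residual.X1.MuLambda

namespace Summit.BirchSwinnertonDyer.BirchSwinnertonDyer.Theorems.PrintX8SmallImageRiderMainConjecture

/-! ### §3 PER PAIR: Sprung's Main Conjecture 7.21 for the unit-content colour, K1-FREE, at rank `0` -/

section MainConjecture

variable (W : WeierstrassCurve ℚ) [W.IsElliptic] [W.IsGloballyMinimal] (p : ℕ) [Fact p.Prime]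

/-- **X8 ∧ `¬ surj(3)` ∧ `r_an = 0`: a SETTLED `BSD(E,3)` + the analytic rider for `•` ⟹ Sprung's Main
Conjecture 7.21 for `(E, 3, •)`, with NO K1 and NO hypothesis on the image beyond «not onto»** — the ♯/♭
twin of K3's image-free converse `kobayashiMainConjecture_of_mu_eq_zero_of_bsdp_of_analyticRank_eq_zero`.
The rider (`hμan`): «for every newform `f` of `W` and its Sprung pair, if `L^• ≠ 0` then `L^•` has a `3`-adic
unit coefficient» (p1 g2's shape, HOME/P1-SharpFlatMuAnSmallImageX8-signature.lean.txt); `BSD(E,3)` (`hB`)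
from ANY source — part 1 §2, or b2b's exact `3`-descent records `bsdp3_nn<label>`
(`Supersingular/NonsplitCartanThreeDescentRecordsX8Three01–05.lean`). Chain, inside the
conjecture's own binders: `μ(X^•) = 0` (`X8.sharpFlatMu_eq_zero`, core at non-surjective image), §1 ⟹
`ξ ∣ L^•`; the rank-`0` exact form `BSD(E,3) ⟺ (ξ) = (L^•)` (b2b `bsdp_iff_span_eq_span_chromaticL_of_analyticRank_eq_zero`,
(K•) by Sprung 2024 §5.2, `3 ∤ c_•` on X8); the Néron generator `ϖ̃ L^•` (`|ϖ|₃ = 1`,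
`X8_norm_periodRatio_eq_one`). Named inputs: `h714`, `h716` (rational clause), `hCK`, `h59`, `h3`, GZK,
`hmod`. PER PAIR; conditional; closes nothing. [cite: Sprung2012, Thm. 7.14, Thm. 7.16 (p. 1504) and Main Conj. 7.21 (p. 1505)]
[cite: Sprung2024, §5.2 Lemmas 5.5–5.9 (pp. 40–41)] [cite: Kato2004Asterisque, Thm. 12.6 (p. 222)]
[cite: GreenbergVatsal2000, §3 Remark 3.4] [cite: Miller2011LMS, Def. 1.1] -/
theorem X8.sprungSharpFlatMainConjecture_of_bsdp_of_sharpFlatMuAn_of_not_surj_of_analyticRank_eq_zero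
    (h714 : thm714_sharpFlatSelmerDual_finite_torsion)
    (h716 : thm716_sharpFlatCharIdeal_divisibility) (hCK : thm714seq_sharpFlatColemanKato_zeta)
    (h59 : lem59AllN_sharpFlatCharValue_rankZero) (h3 : realPeriodRat_eq_unit_mul_plusPeriod_three)
    (hGZK : rank_eq_analyticRank_of_analyticRank_le_one) (hmod : hasEntireLFunction_rat)
    (hX : ClassX8 W p) (hns : ¬ Surj W p) (h0 : W.analyticRank = 0) (hB : BSDp W p) (col : Chroma)
    (hμan : ∀ (N : ℕ) (_ : NeZero N) (f : CuspForm (Gamma0 N) 2) (Lsharp Lflat : IwasawaAlgebra p),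
      IsNewformOf W f → IsSprungPair f p (W.frobeniusTrace p) Lsharp Lflat →
      chromaticL col Lsharp Lflat ≠ 0 → HasUnitContent (chromaticL col Lsharp Lflat)) :
    SprungSharpFlatMainConjecture W p col := by
  intro κ γ hκ hγ hγ' v hv g hg cneg c hc N hN f ϖ Lsharp Lflat hf hϖ hSP hcol D
  haveI := hN
  have hp3 : p = 3 := hX.1
  subst hp3
  have hp2 : (3 : ℕ) ≠ 2 := by decide
  have hgood : W.HasGoodReductionAtPrime 3 := hX.2.1.1
  have hdvd : ((3 : ℕ) : ℤ) ∣ W.frobeniusTrace 3 := hX.2.1.2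
  have hirr : W.HasIrreducibleModPGaloisRep 3 := ClassX8.irr W 3 hX
  have hL : W.entireLFunction 1 ≠ 0 := (W.analyticRank_eq_zero_iff_holds (hmod W)).1 h0
  -- `X^•` finitely generated torsion (Thm. 7.14), a generator of `char X^•`, (K•)
  obtain ⟨hfinD, htorD⟩ :=
    h714 W 3 hp2 hgood hdvd f hf κ γ hκ hγ hγ' v hv g hg cneg c hc col Lsharp Lflat hSP hcol D
  haveI := hfinD
  obtain ⟨gen, hgen⟩ := (charIdeal_isPrincipal_holds 3 D.X).principal
  have hchar : D.charIdeal = Ideal.span {gen} := hgen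
  have hK : (⟨gen, 0, 0⟩ : SignedDatum W 3).EulerCharacteristic := fun hfin =>
    h59 W 3 hp2 hgood hdvd hL κ γ hκ hγ hγ' v hv g hg cneg c hc col D htorD gen hchar hfin
  -- `μ(X^•) = 0` from the rider through the core; §1: integral Kato
  have hμ : muInvariant 3 D.X = 0 :=
    PrintX8SharpFlatMuTransfer.X8.sharpFlatMu_eq_zero W 3 hCK h3 hX hns f hf ϖ hϖ κ γ hκ hγ hγ' v hv
      g hg cneg c hc col hSP (hμan N hN f Lsharp Lflat hf hSP hcol) D
  have hKato : gen ∣ chromaticL col Lsharp Lflat :=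
    sharpFlatUpper_dvd_of_muInvariant_eq_zero h716 hp2 hgood hdvd hf hκ hγ hγ' hv hg hc hSP hcol D htorD
      hchar hμ
  -- rank `0`: `BSD(E,3) ⟺ (gen) = (L^•)`
  have hspan : Ideal.span ({gen} : Set (IwasawaAlgebra 3)) =
      Ideal.span {chromaticL col Lsharp Lflat} :=
    (bsdp_iff_span_eq_span_chromaticL_of_analyticRank_eq_zero W 3 hGZK hp2 hgood hirr hL hf
      (h3 W hgood hirr f hf) hSP col (ClassX8.not_dvd_chromaticConst' W 3 hX col) gen hK hKato).mp hB
  -- the Néron-normalised generator `ϖ̃ · L^•`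
  have hϖ1 : ‖(ϖ : ℚ_[3])‖ = 1 := X8_norm_periodRatio_eq_one h3 W 3 hX hf hϖ
  obtain ⟨hspan', hι'⟩ := span_C_units_mul_eq (PadicInt.mkUnits hϖ1) (chromaticL col Lsharp Lflat)
  refine ⟨htorD, PowerSeries.C ((PadicInt.mkUnits hϖ1 : ℤ_[3]ˣ) : ℤ_[3]) *
    chromaticL col Lsharp Lflat, ?_, ?_⟩
  · rw [hchar, hspan, hspan']
  · rw [hι', PadicInt.mkUnits_eq]

/-- **X8 ∧ `¬ surj(3)` ∧ `r_an = 0` ∧ `ord₃ #Ш_an ≤ 0`: the analytic rider for `•` ALONE ⟹ Sprung's Main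
Conjecture 7.21 for `(E, 3, •)`** — §2 gives `BSD(E,3)`, then the previous theorem. K1-FREE: on the 54
rank-`0` small-image census cells with `3 ∤ #Ш_an`, item 20402's statement for the unit-content colour(s)
is PUB + `hCK` + ONE Mazur–Tate certificate per colour + the `#Ш_an` certificate. Named inputs: `h22`,
`h714`, `h716`, `hCK`, `h59`, `h3`, GZK, `hmod`. PER PAIR; conditional; closes nothing.
[cite: Sprung2012, Thm. 2.2, Thm. 7.14, Thm. 7.16 (p. 1504) and Main Conj. 7.21 (p. 1505)]
[cite: Sprung2024, §5.2 Lemmas 5.5–5.9 (pp. 40–41)] [cite: Miller2011LMS, §1 and Def. 1.1] -/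
theorem X8.sprungSharpFlatMainConjecture_of_sharpFlatMuAn_of_shaAn_le_of_not_surj_of_analyticRank_eq_zero
    (h22 : thm22_exists_isHondaSystem) (h714 : thm714_sharpFlatSelmerDual_finite_torsion)
    (h716 : thm716_sharpFlatCharIdeal_divisibility) (hCK : thm714seq_sharpFlatColemanKato_zeta)
    (h59 : lem59AllN_sharpFlatCharValue_rankZero) (h3 : realPeriodRat_eq_unit_mul_plusPeriod_three)
    (hGZK : rank_eq_analyticRank_of_analyticRank_le_one) (hmod : hasEntireLFunction_rat)
    (hX : ClassX8 W p) (hns : ¬ Surj W p) (h0 : W.analyticRank = 0) (col : Chroma)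
    (hμan : ∀ (N : ℕ) (_ : NeZero N) (f : CuspForm (Gamma0 N) 2) (Lsharp Lflat : IwasawaAlgebra p),
      IsNewformOf W f → IsSprungPair f p (W.frobeniusTrace p) Lsharp Lflat →
      chromaticL col Lsharp Lflat ≠ 0 → HasUnitContent (chromaticL col Lsharp Lflat))
    (hsha : ∃ q : ℚ, shaAn W = (q : ℂ) ∧ padicValRat p q ≤ 0) :
    SprungSharpFlatMainConjecture W p col := by
  intro κ γ hκ hγ hγ' v hv g hg cneg c hc N hN f ϖ Lsharp Lflat hf hϖ hSP hcol D
  haveI := hN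
  have hB : BSDp W p :=
    X8.bsdp_of_hasUnitContent_of_shaAn_le_of_not_surj_of_analyticRank_eq_zero W p h22 h714 h716 hCK h59
      h3 hGZK hmod hX hns h0 hf hSP col (hμan N hN f Lsharp Lflat hf hSP hcol) hsha
  exact X8.sprungSharpFlatMainConjecture_of_bsdp_of_sharpFlatMuAn_of_not_surj_of_analyticRank_eq_zero W p
    h714 h716 hCK h59 h3 hGZK hmod hX hns h0 hB col hμan κ γ hκ hγ hγ' v hv g hg cneg c hc N hN f ϖ
    Lsharp Lflat hf hϖ hSP hcol D

/-- **… hence K1's predicate `SprungSharpFlatLowerDivisibility W 3 •` at the pair (item 19875's statement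
for this `(W, •)`), K1-FREE**, by the edge «main conjecture ⇒ Eisenstein half». PER PAIR; conditional.
[cite: Sprung2012, Main Conj. 1.3 (p. 1486) and Main Conj. 7.21 (p. 1505)] -/
theorem X8.sprungSharpFlatLowerDivisibility_of_sharpFlatMuAn_of_shaAn_le_of_not_surj_of_analyticRank_eq_zero
    (h22 : thm22_exists_isHondaSystem) (h714 : thm714_sharpFlatSelmerDual_finite_torsion)
    (h716 : thm716_sharpFlatCharIdeal_divisibility) (hCK : thm714seq_sharpFlatColemanKato_zeta)
    (h59 : lem59AllN_sharpFlatCharValue_rankZero) (h3 : realPeriodRat_eq_unit_mul_plusPeriod_three)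
    (hGZK : rank_eq_analyticRank_of_analyticRank_le_one) (hmod : hasEntireLFunction_rat)
    (hX : ClassX8 W p) (hns : ¬ Surj W p) (h0 : W.analyticRank = 0) (col : Chroma)
    (hμan : ∀ (N : ℕ) (_ : NeZero N) (f : CuspForm (Gamma0 N) 2) (Lsharp Lflat : IwasawaAlgebra p),
      IsNewformOf W f → IsSprungPair f p (W.frobeniusTrace p) Lsharp Lflat →
      chromaticL col Lsharp Lflat ≠ 0 → HasUnitContent (chromaticL col Lsharp Lflat))
    (hsha : ∃ q : ℚ, shaAn W = (q : ℂ) ∧ padicValRat p q ≤ 0) :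
    SprungSharpFlatLowerDivisibility W p col :=
  sprungSharpFlatLowerDivisibility_of_mainConjecture
    (X8.sprungSharpFlatMainConjecture_of_sharpFlatMuAn_of_shaAn_le_of_not_surj_of_analyticRank_eq_zero W p
      h22 h714 h716 hCK h59 h3 hGZK hmod hX hns h0 col hμan hsha)

end MainConjecture

/-! ### §4 CLASS FORMS on X8 ∩ {¬surj(3)} ∩ {r_an = 0} (∩ {3 ∤ #Ш_an}: 54 of the 61 small-image cells) -/

section ClassForms

/-- **CLASS FORM, the UPPER half: on X8 ∩ {ρ̄_{E,3} not onto} ∩ {r_an = 0}, ONE colour of unit content per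
pair ⟹ `ord₃ #Ш ≤ ord₃ #Ш_an`** (60 census cells) — the small-image complement of p2's
`X8.upperHalf_rankZero_surj_of_sharpFlatFacts` (82 surj cells, no rider), i.e. together: on ALL of X8 ∩
{r_an = 0} the Euler-system half is PUB (+ `hCK`) + the one-colour rider at the 60 non-surjective pairs.
The rider `hrider` is displayed (per pair: one certified Mazur–Tate layer; class-wide = Perrin-Riou 2003
Conj. 7.1, OPEN). Conditional; closes nothing. [cite: Sprung2012, Thm. 7.14 and Thm. 7.16 (p. 1504)]
[cite: Sprung2024, §5.2 Lemmas 5.5–5.9] [cite: PerrinRiou2003, Conj. 7.1 (p. 170)] [cite: Miller2011LMS, Def. 1.1] -/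
theorem upperHalf_smallImage_rankZero_of_oneColourRider
    (hmodf : exists_isNewformOf) (h22 : thm22_exists_isHondaSystem)
    (h714 : thm714_sharpFlatSelmerDual_finite_torsion)
    (h716 : thm716_sharpFlatCharIdeal_divisibility) (hCK : thm714seq_sharpFlatColemanKato_zeta)
    (h59 : lem59AllN_sharpFlatCharValue_rankZero) (h3 : realPeriodRat_eq_unit_mul_plusPeriod_three)
    (hGZK : rank_eq_analyticRank_of_analyticRank_le_one) (hmod : hasEntireLFunction_rat)
    (hrider : ∀ (W : WeierstrassCurve ℚ) [W.IsElliptic] [W.IsGloballyMinimal] (p : ℕ) [Fact p.Prime],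
        ClassX8 W p → ¬ Surj W p → W.analyticRank = 0 →
        ∀ (N : ℕ) (_ : NeZero N) (f : CuspForm (Gamma0 N) 2) (Lsharp Lflat : IwasawaAlgebra p),
        IsNewformOf W f → IsSprungPair f p (W.frobeniusTrace p) Lsharp Lflat →
        ∃ col : Chroma, HasUnitContent (chromaticL col Lsharp Lflat)) :
    ∀ (W : WeierstrassCurve ℚ) [W.IsElliptic] [W.IsGloballyMinimal] (p : ℕ) [Fact p.Prime],
      ClassX8 W p → ¬ Surj W p → W.analyticRank = 0 → MissingUpperBoundAt W p := by
  intro W _ _ p _ hX hns h0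
  have hp3 : p = 3 := hX.1
  subst hp3
  haveI : NeZero (W.conductorNorm ℤ) := ⟨(W.conductorNorm_pos_holds).ne'⟩
  obtain ⟨f, hf⟩ := hmodf W
  obtain ⟨Lsharp, Lflat, hSP⟩ :=
    thm112_exists_isSprungPair_holds (W := W) (f := f) (p := 3) (by decide) hf hX.2.1.1 hX.2.1.2
  obtain ⟨col, hu⟩ := hrider W 3 hX hns h0 _ inferInstance f Lsharp Lflat hf hSP
  exact X8.missingUpperBoundAt_of_hasUnitContent_of_not_surj_of_analyticRank_eq_zero W 3 h22 h714 h716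
    hCK h59 h3 hGZK hmod hX hns h0 hf hSP col hu

/-- **CLASS FORM, `BSD(E,3)`: on X8 ∩ {ρ̄_{E,3} not onto} ∩ {r_an = 0} ∩ {ord₃ #Ш_an ≤ 0}, ONE colour of unit
content per pair ⟹ Miller's `BSD(E,3)`** — 54 of the 61 small-image census cells; K1-FREE, partner-free.
What the leaf `WAllCornerX8` still needs there beyond PUB + `hCK` is EXACTLY the one-colour rider
(decidable per pair; 61/61 read `μ = 0`). Conditional; closes nothing.
[cite: Sprung2012, Thm. 7.14 and Thm. 7.16 (p. 1504)] [cite: Sprung2024, §5.2 Lemmas 5.5–5.9]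
[cite: PerrinRiou2003, Conj. 7.1 (p. 170)] [cite: Miller2011LMS, §1 and Def. 1.1] -/
theorem bsdp_smallImage_rankZero_shaUnit_of_oneColourRider
    (hmodf : exists_isNewformOf) (h22 : thm22_exists_isHondaSystem)
    (h714 : thm714_sharpFlatSelmerDual_finite_torsion)
    (h716 : thm716_sharpFlatCharIdeal_divisibility) (hCK : thm714seq_sharpFlatColemanKato_zeta)
    (h59 : lem59AllN_sharpFlatCharValue_rankZero) (h3 : realPeriodRat_eq_unit_mul_plusPeriod_three)
    (hGZK : rank_eq_analyticRank_of_analyticRank_le_one) (hmod : hasEntireLFunction_rat)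
    (hrider : ∀ (W : WeierstrassCurve ℚ) [W.IsElliptic] [W.IsGloballyMinimal] (p : ℕ) [Fact p.Prime],
        ClassX8 W p → ¬ Surj W p → W.analyticRank = 0 →
        ∀ (N : ℕ) (_ : NeZero N) (f : CuspForm (Gamma0 N) 2) (Lsharp Lflat : IwasawaAlgebra p),
        IsNewformOf W f → IsSprungPair f p (W.frobeniusTrace p) Lsharp Lflat →
        ∃ col : Chroma, HasUnitContent (chromaticL col Lsharp Lflat)) :
    ∀ (W : WeierstrassCurve ℚ) [W.IsElliptic] [W.IsGloballyMinimal] (p : ℕ) [Fact p.Prime],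
      ClassX8 W p → ¬ Surj W p → W.analyticRank = 0 →
      (∃ q : ℚ, shaAn W = (q : ℂ) ∧ padicValRat p q ≤ 0) → BSDp W p := by
  intro W _ _ p _ hX hns h0 hsha
  refine bsdp_of_missingPPartAt W p hGZK (by omega) (missingPPartAt_of_lower_of_upper W p ?_
    (upperHalf_smallImage_rankZero_of_oneColourRider hmodf h22 h714 h716 hCK h59 h3 hGZK hmod hrider W p
      hX hns h0))
  obtain ⟨q, hq, hle⟩ := hsha
  exact ⟨q, hq, hle.trans (by exact_mod_cast Nat.zero_le _)⟩

/-- **CLASS FORM, the ♯/♭ main conjecture (BOTH colours) and K1: on X8 ∩ {ρ̄_{E,3} not onto} ∩ {r_an = 0}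
∩ {ord₃ #Ш_an ≤ 0}, p1 g2's per-colour rider `SharpFlatMuAn` (every non-zero colour has unit content; both
colours on 61/61 census cells) ⟹ Sprung's Main Conjecture 7.21 for every colour — i.e. the statement of
item 20402 `SharpFlatMainConjectureSmallImageX8` AND of item 19875 (K1) restricted to those pairs —
K1-FREE.** Reading for the planner: on 54 of the 61 small-image cells neither open crux of route PrintX8 is
needed beyond PUB + `hCK` + per-pair certificates; the residual of the small-image branch shrinks to the 6
rank-`0` cells with `3 ∣ #Ш_an` (lower half) + the rank-`1` cell. Conditional; closes nothing.
[cite: Sprung2012, Main Conj. 7.21 (p. 1505)] [cite: Sprung2024, §5.2 Lemmas 5.5–5.9]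
[cite: PerrinRiou2003, Conj. 7.1 (p. 170)] [cite: Miller2011LMS, Def. 1.1] -/
theorem sharpFlatMainConjecture_smallImage_rankZero_shaUnit_of_sharpFlatMuAn
    (h22 : thm22_exists_isHondaSystem) (h714 : thm714_sharpFlatSelmerDual_finite_torsion)
    (h716 : thm716_sharpFlatCharIdeal_divisibility) (hCK : thm714seq_sharpFlatColemanKato_zeta)
    (h59 : lem59AllN_sharpFlatCharValue_rankZero) (h3 : realPeriodRat_eq_unit_mul_plusPeriod_three)
    (hGZK : rank_eq_analyticRank_of_analyticRank_le_one) (hmod : hasEntireLFunction_rat)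
    (hμan : ∀ (W : WeierstrassCurve ℚ) [W.IsElliptic] [W.IsGloballyMinimal] (p : ℕ) [Fact p.Prime],
        ClassX8 W p → ¬ Surj W p → ∀ (col : Chroma)
        (N : ℕ) (_ : NeZero N) (f : CuspForm (Gamma0 N) 2) (Lsharp Lflat : IwasawaAlgebra p),
        IsNewformOf W f → IsSprungPair f p (W.frobeniusTrace p) Lsharp Lflat →
        chromaticL col Lsharp Lflat ≠ 0 → HasUnitContent (chromaticL col Lsharp Lflat)) :
    ∀ (W : WeierstrassCurve ℚ) [W.IsElliptic] [W.IsGloballyMinimal] (p : ℕ) [Fact p.Prime],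
      ClassX8 W p → ¬ Surj W p → W.analyticRank = 0 →
      (∃ q : ℚ, shaAn W = (q : ℂ) ∧ padicValRat p q ≤ 0) →
      ∀ col : Chroma, SprungSharpFlatMainConjecture W p col ∧ SprungSharpFlatLowerDivisibility W p col := by
  intro W _ _ p _ hX hns h0 hsha col
  have hMC :=
    X8.sprungSharpFlatMainConjecture_of_sharpFlatMuAn_of_shaAn_le_of_not_surj_of_analyticRank_eq_zero W p
      h22 h714 h716 hCK h59 h3 hGZK hmod hX hns h0 col (hμan W p hX hns col) hsha
  exact ⟨hMC, sprungSharpFlatLowerDivisibility_of_mainConjecture hMC⟩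

end ClassForms

/-! ### §5 RECORD LEVEL: ty3's certified census records (`Record.Claim`) + ONE Mazur–Tate layer ⟹ `BSD(E,3)` -/

section Records

open Summit.BirchSwinnertonDyer.Rank1Residual.PrintX8

/-- **The per-cell consumer for the 54 rank-`0` small-image cells with `3 ∤ #Ш_an`.** Let `r` be one of
ty3's certificate records (`Rank1Residual/PrintX8/CertificateRecords*.lean`, kernel-rechecked by
`Record.check`) and grant its `Claim` (the record's curve is the X8 pair it names: `ClassX8`, analytic
rank `= r.rank`, `#Ш_an = r.shaAn`, mod-`3` image bit). If `r.surj3 = false` (resolvent-root certificate: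
`ρ̄_{E,3}` NOT onto), `r.rank = 0` and `ord₃ r.shaAn = 0`, then ONE certified Mazur–Tate layer of the
newform `f` of the curve (`Θ ∈ Λ` with `ι Θ = θ_n(f)`, `Θ ≠ 0`, `μ(Θ) = 0`; any parity `n`) gives Miller's
`BSD(E,3)` for `r.curve` — from the PUBLISHED named facts `h22`, `h714`, `h716`, `h59`, `h3`, GZK, `hmod`
and the construction fact `hCK` BY NAME; NO K1, NO congruence partner. PER RECORD; conditional on the
claim, the facts and the layer certificate; books nothing. [cite: Sprung2012, Thm. 7.14 and Thm. 7.16 (p. 1504)]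
[cite: Sprung2024, §5.2 Lemmas 5.5–5.9] [cite: Pollack2003, Prop. 6.9 and Prop. 6.10]
[cite: Sprung2017, §3.1, Cor. 4.4 and Thm. 1.12] [cite: Miller2011LMS, §1 and Def. 1.1] -/
theorem certificateRecord_bsdp_of_mazurTate_smallImage_rankZero_shaUnit
    (h22 : thm22_exists_isHondaSystem) (h714 : thm714_sharpFlatSelmerDual_finite_torsion)
    (h716 : thm716_sharpFlatCharIdeal_divisibility) (hCK : thm714seq_sharpFlatColemanKato_zeta)
    (h59 : lem59AllN_sharpFlatCharValue_rankZero) (h3 : realPeriodRat_eq_unit_mul_plusPeriod_three)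
    (hGZK : rank_eq_analyticRank_of_analyticRank_le_one) (hmod : hasEntireLFunction_rat)
    (r : Record) [r.curve.IsElliptic] [r.curve.IsGloballyMinimal] (h : r.Claim)
    (hs : r.surj3 = false) (hr : r.rank = 0) (h0 : padicValNat 3 r.shaAn = 0)
    {N : ℕ} [NeZero N] {f : CuspForm (Gamma0 N) 2} (hf : IsNewformOf r.curve f)
    {Lsharp Lflat : IwasawaAlgebra 3} (hSP : IsSprungPair f 3 (r.curve.frobeniusTrace 3) Lsharp Lflat)
    {n : ℕ} {Θ : IwasawaAlgebra 3}
    (hΘ : iwasawaToPowerSeries 3 Θ =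
      ((mazurTateElement f 3 n).map (algebraMap ℚ ℚ_[3]) : PowerSeries ℚ_[3]))
    (hΘ0 : Θ ≠ 0) (hμΘ : mu Θ = 0) : BSDp r.curve 3 := by
  obtain ⟨hrank, -, -, hsha⟩ := r.invariants_of_claim h
  have h0' : r.curve.analyticRank = 0 := by rw [hrank, hr]
  have hsha' : ∃ q : ℚ, shaAn r.curve = (q : ℂ) ∧ padicValRat 3 q ≤ 0 := by
    refine ⟨r.shaAn, by rw [hsha]; norm_cast, ?_⟩
    rw [padicValRat.of_nat]
    exact_mod_cast h0.le
  exact X8.bsdp_of_mazurTate_of_shaAn_le_of_not_surj_of_analyticRank_eq_zero r.curve 3 h22 h714 h716 hCK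
    h59 h3 hGZK hmod (r.classX8_of_claim h) (r.not_surj_of_claim h hs) h0' hf hSP hΘ hΘ0 hμΘ hsha'

end Records

end Summit.BirchSwinnertonDyer.BirchSwinnertonDyer.Theorems.PrintX8SmallImageRiderMainConjecture

end
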